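import Mathlib.AlgebraicGeometry.EllipticCurve.Affine.Point
import Mathlib.Tactic
import HarnessLib

/-!
# The Frey curves of Bennett–Skinner for `A xⁿ + B yⁿ = C z²` and their invariants

M. A. Bennett, C. M. Skinner, *Ternary Diophantine equations via Galois representations and
modular forms*, Canad. J. Math. **56** (2004) 23–54 [BennettSkinner2004], §2 ("Some elliptic
curves"), pp. 26–28. For an integral solution `(a, b, c)` of `A aⁿ + B bⁿ = C c²` (`n` an odd prime,
`aA, bB, cC` pairwise coprime, `C` squarefree) the paper attaches, according to the 2-adic case
(i)–(v), one of the curves (verbatim, p. 27)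

* `E₁(a, b, c) : Y² = X³ + 2cC X² + BC bⁿ X` (cases (i), (ii)),
* `E₂(a, b, c) : Y² = X³ + cC X² + (BC bⁿ/4) X` (cases (iii), (iv)),
* `E₃(a, b, c) : Y² + XY = X³ + ((cC − 1)/4) X² + (BC bⁿ/64) X` (case (v)),

and records in **Lemma 2.1**: *(a)* `Δ(E_i) = 2^{δ_i} C³ B² A (ab²)ⁿ` with `δ₁ = 6, δ₂ = 0, δ₃ = −12`;
*(b)* the conductor `N(E_i) = 2^α C² ∏_{p ∣ abAB} p` (Tate's algorithm); *(c)* `E_i` has a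
`ℚ`-rational point of order `2`; *(d)* potentially good reduction at the odd primes of `C`. The
printed proof of (b), case (i), passes through "`ord₂ c₄(E) = 4`, `ord₂ c₆(E) ≥ 6` and
`ord₂ Δ(E) = 6`" (p. 28).

This file TYPES the three curves as `WeierstrassCurve`s and PROVES, as polynomial identities from
the relation `A aⁿ + B bⁿ = C c²`: Lemma 2.1(a) for `i = 1, 2, 3` (`Δ_E₁`, `Δ_E₂`, `Δ_E₃`), the
closed forms of `c₄`, `c₆` (`c₄_E₁`, `c₆_E₁`, `c₄_E₂`, `c₄_E₃`), the three 2-adic facts of the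
proof of (b) in case (i) (`two_adic_caseI`, and `c₄_caseI_mod_four`: `c₄/2⁴ ≡ −1 (mod 4)`), non-singularity (`Δ_E₁_ne_zero`) and Lemma 2.1(c)
(`twoTorsion_E₁/E₂/E₃`: `(0, 0)` is a nonsingular point equal to its own negative, hence of order 2).
NOT here: part (b) itself (conductor exponents — Tate's algorithm / [Papadopoulos] is not in
Mathlib), part (d), and anything about the mod-`n` representation. `E₁` is stated over any
commutative ring (its coefficients are integral); `E₂`, `E₃` over a field (they divide by `4`, `64`;
over a field of characteristic `2` the division is Lean's junk value `x / 0 = 0`, and the lemmas that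
need `2 ≠ 0` say so).
-/

namespace Literature.NumberTheory.DiophantineGeometry

namespace BennettSkinner2004

open WeierstrassCurve

section Ring

variable {R : Type*} [CommRing R]

/-- `E₁(a, b, c) : Y² = X³ + 2cC·X² + BC bⁿ·X`, the Frey curve of cases (i), (ii)
(Weierstrass coefficients `a₁ = a₃ = a₆ = 0`, `a₂ = 2cC`, `a₄ = BC bⁿ`). It does not depend on `a`, `A`
explicitly; they enter through `A aⁿ + B bⁿ = C c²`. [cite: BennettSkinner2004, §2 (p. 27)] -/
def E₁ (B C b c : R) (n : ℕ) : WeierstrassCurve R :=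
  { a₁ := 0, a₂ := 2 * c * C, a₃ := 0, a₄ := B * C * b ^ n, a₆ := 0 }

variable (B C b c : R) (n : ℕ)

/-- The coefficient `a₁` of `E₁` is `0` (as printed). [cite: BennettSkinner2004, §2 (p. 27)] -/
@[simp] theorem E₁_a₁ : (E₁ B C b c n).a₁ = 0 := rfl
/-- The coefficient `a₂` of `E₁` is `2cC` (as printed). [cite: BennettSkinner2004, §2 (p. 27)] -/
@[simp] theorem E₁_a₂ : (E₁ B C b c n).a₂ = 2 * c * C := rfl
/-- The coefficient `a₃` of `E₁` is `0` (as printed). [cite: BennettSkinner2004, §2 (p. 27)] -/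
@[simp] theorem E₁_a₃ : (E₁ B C b c n).a₃ = 0 := rfl
/-- The coefficient `a₄` of `E₁` is `BC bⁿ` (as printed). [cite: BennettSkinner2004, §2 (p. 27)] -/
@[simp] theorem E₁_a₄ : (E₁ B C b c n).a₄ = B * C * b ^ n := rfl
/-- The coefficient `a₆` of `E₁` is `0` (as printed). [cite: BennettSkinner2004, §2 (p. 27)] -/
@[simp] theorem E₁_a₆ : (E₁ B C b c n).a₆ = 0 := rfl

/-- `b₂(E₁) = 8cC`. [cite: BennettSkinner2004, §2 / Lemma 2.1 proof ("straightforward calculation")] -/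
theorem b₂_E₁ : (E₁ B C b c n).b₂ = 8 * c * C := by
  simp [WeierstrassCurve.b₂]; ring

/-- `b₄(E₁) = 2BC bⁿ`. [cite: BennettSkinner2004, §2 / Lemma 2.1 proof] -/
theorem b₄_E₁ : (E₁ B C b c n).b₄ = 2 * B * C * b ^ n := by
  simp [WeierstrassCurve.b₄]; ring

/-- `b₆(E₁) = 0`. [cite: BennettSkinner2004, §2 / Lemma 2.1 proof] -/
theorem b₆_E₁ : (E₁ B C b c n).b₆ = 0 := by
  simp [WeierstrassCurve.b₆]

/-- `b₈(E₁) = −(BC bⁿ)²`. [cite: BennettSkinner2004, §2 / Lemma 2.1 proof] -/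
theorem b₈_E₁ : (E₁ B C b c n).b₈ = -(B * C * b ^ n) ^ 2 := by
  simp [WeierstrassCurve.b₈]

/-- `c₄(E₁) = 16·C·(4c²C − 3B bⁿ)`. [cite: BennettSkinner2004, Lemma 2.1 (proof of (b), p. 28)] -/
theorem c₄_E₁ : (E₁ B C b c n).c₄ = 16 * C * (4 * c ^ 2 * C - 3 * B * b ^ n) := by
  simp only [WeierstrassCurve.c₄, b₂_E₁, b₄_E₁]; ring

/-- `c₆(E₁) = −64·cC²·(8c²C − 9B bⁿ)`. [cite: BennettSkinner2004, Lemma 2.1 (proof of (b), p. 28)] -/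
theorem c₆_E₁ : (E₁ B C b c n).c₆ = -64 * c * C ^ 2 * (8 * c ^ 2 * C - 9 * B * b ^ n) := by
  simp only [WeierstrassCurve.c₆, b₂_E₁, b₄_E₁, b₆_E₁]; ring

/-- The discriminant of `E₁` before using the ternary relation:
`Δ(E₁) = 64·B²C³ b²ⁿ·(c²C − B bⁿ)`. [cite: BennettSkinner2004, Lemma 2.1(a)] -/
theorem Δ_E₁' : (E₁ B C b c n).Δ = 64 * B ^ 2 * C ^ 3 * b ^ (2 * n) * (c ^ 2 * C - B * b ^ n) := by
  simp only [WeierstrassCurve.Δ, b₂_E₁, b₄_E₁, b₆_E₁, b₈_E₁]; ring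

/-- **Lemma 2.1(a), `i = 1`**: if `A aⁿ + B bⁿ = C c²` then `Δ(E₁(a,b,c)) = 2⁶ C³ B² A (ab²)ⁿ`.
[cite: BennettSkinner2004, Lemma 2.1(a)] -/
theorem Δ_E₁ {A B C a b c : R} {n : ℕ} (h : A * a ^ n + B * b ^ n = C * c ^ 2) :
    (E₁ B C b c n).Δ = 2 ^ 6 * C ^ 3 * B ^ 2 * A * (a * b ^ 2) ^ n := by
  rw [Δ_E₁', mul_pow, ← pow_mul, mul_comm 2 n, pow_mul]
  linear_combination (-(64 * B ^ 2 * C ^ 3 * (b ^ n) ^ 2)) * h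

/-- With the ternary relation, `c₄(E₁) = 16·C·(4A aⁿ + B bⁿ)`.
[cite: BennettSkinner2004, Lemma 2.1 (proof of (b))] -/
theorem c₄_E₁_of_rel {A B C a b c : R} {n : ℕ} (h : A * a ^ n + B * b ^ n = C * c ^ 2) :
    (E₁ B C b c n).c₄ = 16 * C * (4 * A * a ^ n + B * b ^ n) := by
  rw [c₄_E₁]; linear_combination (-(64 * C)) * h

/-- **The 2-adic data of the printed proof of Lemma 2.1(b), case (i)** (`abABC` odd, hence `c`
even): `c₄(E₁) = 2⁴·(odd)`, `2⁷ ∣ c₆(E₁)`, `Δ(E₁) = 2⁶·(odd)` — i.e. "`ord₂ c₄(E) = 4`,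
`ord₂ c₆(E) ≥ 6` and `ord₂ Δ(E) = 6`" (p. 28), over `ℤ`. The deduction "hence conductor exponent
`α = 5`" (Papadopoulos, Tableau IV) is NOT formalised. [cite: BennettSkinner2004, Lemma 2.1 (proof of (b), case (i))] -/
theorem two_adic_caseI {A B C a b c : ℤ} {n : ℕ} (h : A * a ^ n + B * b ^ n = C * c ^ 2)
    (hA : Odd A) (hB : Odd B) (hC : Odd C) (ha : Odd a) (hb : Odd b) (hc : Even c) :
    (∃ m, Odd m ∧ (E₁ B C b c n).c₄ = 2 ^ 4 * m) ∧ 2 ^ 7 ∣ (E₁ B C b c n).c₆ ∧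
      (∃ m, Odd m ∧ (E₁ B C b c n).Δ = 2 ^ 6 * m) := by
  refine ⟨⟨C * (4 * c ^ 2 * C - 3 * B * b ^ n), ?_, by rw [c₄_E₁]; ring⟩, ?_,
    ⟨C ^ 3 * B ^ 2 * A * (a * b ^ 2) ^ n, ?_, by rw [Δ_E₁ h]; ring⟩⟩
  · -- `C` odd and `4c²C − 3B bⁿ = even − odd` odd
    have h3 : Odd (3 * B * b ^ n) := (Int.odd_mul.2 ⟨Int.odd_mul.2 ⟨by decide, hB⟩, hb.pow⟩)
    have h4 : Even (4 * c ^ 2 * C) := ⟨2 * c ^ 2 * C, by ring⟩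
    exact Int.odd_mul.2 ⟨hC, by simpa using h4.sub_odd h3⟩
  · obtain ⟨k, hk⟩ := hc
    rw [c₆_E₁, hk]
    exact ⟨-(k * C ^ 2 * (8 * (k + k) ^ 2 * C - 9 * B * b ^ n)), by ring⟩
  · have hab : Odd (a * b ^ 2) := Int.odd_mul.2 ⟨ha, hb.pow⟩
    exact Int.odd_mul.2 ⟨Int.odd_mul.2 ⟨Int.odd_mul.2 ⟨hC.pow, hB.pow⟩, hA⟩, hab.pow⟩

/-- **Case (i) refinement used by the 2-adic/symplectic readings**: if `B`, `C` are odd,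
`b ≡ −BC (mod 4)` (the normalisation of case (i), p. 26) and `n` is odd, then
`c₄(E₁) = 2⁴·m` with `m ≡ 3 (mod 4)`, i.e. `c₄/2⁴ ≡ −1 (mod 4)`
(`m = C(4c²C − 3B bⁿ) ≡ −3BC bⁿ ≡ −3BC·b ≡ 3(BC)² ≡ 3`).
[cite: BennettSkinner2004, §2 case (i) + Lemma 2.1 (proof of (b))] -/
theorem c₄_caseI_mod_four {B C b c : ℤ} {n : ℕ} (hB : Odd B) (hC : Odd C) (hn : Odd n)
    (hbBC : b ≡ -(B * C) [ZMOD 4]) :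
    ∃ m, m ≡ 3 [ZMOD 4] ∧ (E₁ B C b c n).c₄ = 2 ^ 4 * m := by
  refine ⟨C * (4 * c ^ 2 * C - 3 * B * b ^ n), ?_, by rw [c₄_E₁]; ring⟩
  have h4 : (4 : ZMod 4) = 0 := by decide
  have hsq : ∀ u : ℤ, Odd u → ((u : ZMod 4)) ^ 2 = 1 := by
    rintro u ⟨t, rfl⟩
    push_cast
    linear_combination ((t : ZMod 4) ^ 2 + t) * h4
  have hb4 : ((b : ℤ) : ZMod 4) = -((B : ZMod 4) * C) := by
    have h := (ZMod.intCast_eq_intCast_iff b (-(B * C)) 4).2 (by exact_mod_cast hbBC)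
    push_cast at h
    exact h
  obtain ⟨k, rfl⟩ := hn
  have hp : ((-((B : ZMod 4) * C)) ^ 2) ^ k = 1 := by
    rw [neg_sq, mul_pow, hsq B hB, hsq C hC, one_mul, one_pow]
  have key : ((C * (4 * c ^ 2 * C - 3 * B * b ^ (2 * k + 1)) : ℤ) : ZMod 4) = ((3 : ℤ) : ZMod 4) := by
    push_cast
    rw [hb4, pow_succ (-((B : ZMod 4) * C)) (2 * k), pow_mul (-((B : ZMod 4) * C)) 2 k, hp]
    linear_combination (3 * (C : ZMod 4) ^ 2) * hsq B hB + 3 * hsq C hC +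
      ((c : ZMod 4) ^ 2 * (C : ZMod 4) ^ 2) * h4
  exact_mod_cast (ZMod.intCast_eq_intCast_iff _ _ 4).1 key

end Ring

section Field

variable {K : Type*} [Field K]

/-- `E₂(a, b, c) : Y² = X³ + cC·X² + (BC bⁿ/4)·X`, the Frey curve of cases (iii), (iv).
[cite: BennettSkinner2004, §2 (p. 27)] -/
def E₂ (B C b c : K) (n : ℕ) : WeierstrassCurve K :=
  { a₁ := 0, a₂ := c * C, a₃ := 0, a₄ := B * C * b ^ n / 4, a₆ := 0 }

/-- `E₃(a, b, c) : Y² + XY = X³ + ((cC − 1)/4)·X² + (BC bⁿ/64)·X`, the Frey curve of case (v).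
[cite: BennettSkinner2004, §2 (p. 27)] -/
def E₃ (B C b c : K) (n : ℕ) : WeierstrassCurve K :=
  { a₁ := 1, a₂ := (c * C - 1) / 4, a₃ := 0, a₄ := B * C * b ^ n / 64, a₆ := 0 }

variable (B C b c : K) (n : ℕ)

/-- The coefficient `a₁` of `E₂` is `0` (as printed). [cite: BennettSkinner2004, §2 (p. 27)] -/
@[simp] theorem E₂_a₁ : (E₂ B C b c n).a₁ = 0 := rfl
/-- The coefficient `a₂` of `E₂` is `cC` (as printed). [cite: BennettSkinner2004, §2 (p. 27)] -/
@[simp] theorem E₂_a₂ : (E₂ B C b c n).a₂ = c * C := rfl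
/-- The coefficient `a₃` of `E₂` is `0` (as printed). [cite: BennettSkinner2004, §2 (p. 27)] -/
@[simp] theorem E₂_a₃ : (E₂ B C b c n).a₃ = 0 := rfl
/-- The coefficient `a₄` of `E₂` is `BC bⁿ/4` (as printed). [cite: BennettSkinner2004, §2 (p. 27)] -/
@[simp] theorem E₂_a₄ : (E₂ B C b c n).a₄ = B * C * b ^ n / 4 := rfl
/-- The coefficient `a₆` of `E₂` is `0` (as printed). [cite: BennettSkinner2004, §2 (p. 27)] -/
@[simp] theorem E₂_a₆ : (E₂ B C b c n).a₆ = 0 := rfl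
/-- The coefficient `a₁` of `E₃` is `1` (as printed). [cite: BennettSkinner2004, §2 (p. 27)] -/
@[simp] theorem E₃_a₁ : (E₃ B C b c n).a₁ = 1 := rfl
/-- The coefficient `a₂` of `E₃` is `(cC − 1)/4` (as printed). [cite: BennettSkinner2004, §2 (p. 27)] -/
@[simp] theorem E₃_a₂ : (E₃ B C b c n).a₂ = (c * C - 1) / 4 := rfl
/-- The coefficient `a₃` of `E₃` is `0` (as printed). [cite: BennettSkinner2004, §2 (p. 27)] -/
@[simp] theorem E₃_a₃ : (E₃ B C b c n).a₃ = 0 := rfl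
/-- The coefficient `a₄` of `E₃` is `BC bⁿ/64` (as printed). [cite: BennettSkinner2004, §2 (p. 27)] -/
@[simp] theorem E₃_a₄ : (E₃ B C b c n).a₄ = B * C * b ^ n / 64 := rfl
/-- The coefficient `a₆` of `E₃` is `0` (as printed). [cite: BennettSkinner2004, §2 (p. 27)] -/
@[simp] theorem E₃_a₆ : (E₃ B C b c n).a₆ = 0 := rfl

section TwoInvertible

variable [NeZero (2 : K)]

/-- `4 ≠ 0` in a field with `2 ≠ 0` (plumbing). [folklore] -/
private theorem four_ne_zero' : (4 : K) ≠ 0 := by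
  have h2 : (2 : K) ≠ 0 := NeZero.ne 2
  have : (4 : K) = 2 * 2 := by norm_num
  rw [this]; exact mul_ne_zero h2 h2

/-- `2ᵏ ≠ 0` in a field with `2 ≠ 0` (plumbing). [folklore] -/
private theorem pow_two_ne_zero' (k : ℕ) : ((2 : K) ^ k) ≠ 0 := pow_ne_zero k (NeZero.ne 2)

/-- `b₂(E₂) = 4cC`, `b₄(E₂) = BC bⁿ/2`, `b₆(E₂) = 0`, `b₈(E₂) = −(BC bⁿ)²/16` (`2 ≠ 0` in `K`).
[cite: BennettSkinner2004, Lemma 2.1 (proof)] -/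
theorem b_E₂ : (E₂ B C b c n).b₂ = 4 * c * C ∧ (E₂ B C b c n).b₄ = B * C * b ^ n / 2 ∧
    (E₂ B C b c n).b₆ = 0 ∧ (E₂ B C b c n).b₈ = -(B * C * b ^ n) ^ 2 / 16 := by
  have h4 := four_ne_zero' (K := K)
  have h2 : (2 : K) ≠ 0 := NeZero.ne 2
  have h16 : (16 : K) ≠ 0 := by
    have : (16 : K) = 2 ^ 4 := by norm_num
    rw [this]; exact pow_two_ne_zero' 4
  refine ⟨?_, ?_, ?_, ?_⟩
  · simp [WeierstrassCurve.b₂]; ring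
  · simp [WeierstrassCurve.b₄]; field_simp; ring
  · simp [WeierstrassCurve.b₆]
  · simp [WeierstrassCurve.b₈]; field_simp; ring

/-- `b₂(E₃) = cC`, `b₄(E₃) = BC bⁿ/32`, `b₆(E₃) = 0`, `b₈(E₃) = −(BC bⁿ)²/4096` (`2 ≠ 0` in `K`).
[cite: BennettSkinner2004, Lemma 2.1 (proof)] -/
theorem b_E₃ : (E₃ B C b c n).b₂ = c * C ∧ (E₃ B C b c n).b₄ = B * C * b ^ n / 32 ∧
    (E₃ B C b c n).b₆ = 0 ∧ (E₃ B C b c n).b₈ = -(B * C * b ^ n) ^ 2 / 4096 := by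
  have h4 := four_ne_zero' (K := K)
  have h32 : (32 : K) ≠ 0 := by
    have : (32 : K) = 2 ^ 5 := by norm_num
    rw [this]; exact pow_two_ne_zero' 5
  have h64 : (64 : K) ≠ 0 := by
    have : (64 : K) = 2 ^ 6 := by norm_num
    rw [this]; exact pow_two_ne_zero' 6
  have h4096 : (4096 : K) ≠ 0 := by
    have : (4096 : K) = 2 ^ 12 := by norm_num
    rw [this]; exact pow_two_ne_zero' 12
  refine ⟨?_, ?_, ?_, ?_⟩
  · simp [WeierstrassCurve.b₂]; field_simp; ring
  · simp [WeierstrassCurve.b₄]; field_simp; ring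
  · simp [WeierstrassCurve.b₆]
  · simp [WeierstrassCurve.b₈]; field_simp; ring

/-- `c₄(E₂) = 4·C·(4c²C − 3B bⁿ)`. [cite: BennettSkinner2004, Lemma 2.1 (proof)] -/
theorem c₄_E₂ : (E₂ B C b c n).c₄ = 4 * C * (4 * c ^ 2 * C - 3 * B * b ^ n) := by
  obtain ⟨h₂, h₄, -, -⟩ := b_E₂ B C b c n
  have h2 : (2 : K) ≠ 0 := NeZero.ne 2
  rw [WeierstrassCurve.c₄, h₂, h₄]; field_simp; ring

/-- `c₄(E₃) = C·(4c²C − 3B bⁿ)/4`. [cite: BennettSkinner2004, Lemma 2.1 (proof)] -/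
theorem c₄_E₃ : (E₃ B C b c n).c₄ = C * (4 * c ^ 2 * C - 3 * B * b ^ n) / 4 := by
  obtain ⟨h₂, h₄, -, -⟩ := b_E₃ B C b c n
  have h4 := four_ne_zero' (K := K)
  have h32 : (32 : K) ≠ 0 := by
    have : (32 : K) = 2 ^ 5 := by norm_num
    rw [this]; exact pow_two_ne_zero' 5
  rw [WeierstrassCurve.c₄, h₂, h₄]; field_simp; ring

/-- `Δ(E₂) = B²C³ b²ⁿ (c²C − B bⁿ)` before using the ternary relation.
[cite: BennettSkinner2004, Lemma 2.1(a)] -/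
theorem Δ_E₂' : (E₂ B C b c n).Δ = B ^ 2 * C ^ 3 * b ^ (2 * n) * (c ^ 2 * C - B * b ^ n) := by
  obtain ⟨h₂, h₄, h₆, h₈⟩ := b_E₂ B C b c n
  have h2 : (2 : K) ≠ 0 := NeZero.ne 2
  have h16 : (16 : K) ≠ 0 := by
    have : (16 : K) = 2 ^ 4 := by norm_num
    rw [this]; exact pow_two_ne_zero' 4
  rw [WeierstrassCurve.Δ, h₂, h₄, h₆, h₈, show b ^ (2 * n) = (b ^ n) ^ 2 by ring]
  field_simp; ring

/-- `Δ(E₃) = B²C³ b²ⁿ (c²C − B bⁿ)/2¹²` before using the ternary relation.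
[cite: BennettSkinner2004, Lemma 2.1(a)] -/
theorem Δ_E₃' : (E₃ B C b c n).Δ =
    B ^ 2 * C ^ 3 * b ^ (2 * n) * (c ^ 2 * C - B * b ^ n) / 2 ^ 12 := by
  obtain ⟨h₂, h₄, h₆, h₈⟩ := b_E₃ B C b c n
  have h32 : (32 : K) ≠ 0 := by
    have : (32 : K) = 2 ^ 5 := by norm_num
    rw [this]; exact pow_two_ne_zero' 5
  have h4096 : (4096 : K) ≠ 0 := by
    have : (4096 : K) = 2 ^ 12 := by norm_num
    rw [this]; exact pow_two_ne_zero' 12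
  have hp : ((2 : K) ^ 12) ≠ 0 := pow_two_ne_zero' 12
  rw [WeierstrassCurve.Δ, h₂, h₄, h₆, h₈, show b ^ (2 * n) = (b ^ n) ^ 2 by ring]
  field_simp; ring

/-- **Lemma 2.1(a), `i = 2`**: if `A aⁿ + B bⁿ = C c²` then `Δ(E₂(a,b,c)) = C³ B² A (ab²)ⁿ`
(`δ₂ = 0`; needs `2 ≠ 0` in `K`). [cite: BennettSkinner2004, Lemma 2.1(a)] -/
theorem Δ_E₂ {A B C a b c : K} {n : ℕ} (h : A * a ^ n + B * b ^ n = C * c ^ 2) :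
    (E₂ B C b c n).Δ = C ^ 3 * B ^ 2 * A * (a * b ^ 2) ^ n := by
  rw [Δ_E₂', show b ^ (2 * n) = (b ^ n) ^ 2 by ring,
    show (a * b ^ 2) ^ n = a ^ n * (b ^ n) ^ 2 by ring]
  linear_combination (-(B ^ 2 * C ^ 3 * (b ^ n) ^ 2)) * h

/-- **Lemma 2.1(a), `i = 3`**: if `A aⁿ + B bⁿ = C c²` then `Δ(E₃(a,b,c)) = 2⁻¹² C³ B² A (ab²)ⁿ`
(`δ₃ = −12`, written as a division by `2¹²`; needs `2 ≠ 0` in `K`).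
[cite: BennettSkinner2004, Lemma 2.1(a)] -/
theorem Δ_E₃ {A B C a b c : K} {n : ℕ} (h : A * a ^ n + B * b ^ n = C * c ^ 2) :
    (E₃ B C b c n).Δ = C ^ 3 * B ^ 2 * A * (a * b ^ 2) ^ n / 2 ^ 12 := by
  rw [Δ_E₃', show b ^ (2 * n) = (b ^ n) ^ 2 by ring,
    show (a * b ^ 2) ^ n = a ^ n * (b ^ n) ^ 2 by ring]
  linear_combination (-(B ^ 2 * C ^ 3 * (b ^ n) ^ 2) / 2 ^ 12) * h

/-- `E₁` is an elliptic curve (non-zero discriminant) as soon as `abABC ≠ 0` (over a field with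
`2 ≠ 0`, because of the factor `2⁶`).
[cite: BennettSkinner2004, §2 ("These are all elliptic curves defined over ℚ")] -/
theorem Δ_E₁_ne_zero {A B C a b c : K} {n : ℕ}
    (h : A * a ^ n + B * b ^ n = C * c ^ 2) (hA : A ≠ 0) (hB : B ≠ 0) (hC : C ≠ 0) (ha : a ≠ 0)
    (hb : b ≠ 0) : (E₁ B C b c n).Δ ≠ 0 := by
  rw [Δ_E₁ h]
  have h2 : (2 : K) ^ 6 ≠ 0 := pow_two_ne_zero' 6
  have hab : (a * b ^ 2) ^ n ≠ 0 := pow_ne_zero n (mul_ne_zero ha (pow_ne_zero 2 hb))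
  exact mul_ne_zero (mul_ne_zero (mul_ne_zero (mul_ne_zero h2 (pow_ne_zero 3 hC))
    (pow_ne_zero 2 hB)) hA) hab

end TwoInvertible

section Torsion

variable [DecidableEq K]

omit [DecidableEq K] in
/-- **Lemma 2.1(c)** in the form used: on a Weierstrass curve with `a₆ = 0` and `a₄ ≠ 0` the
point `(0, 0)` is nonsingular. [cite: BennettSkinner2004, Lemma 2.1(c) (proof: "(X, Y) = (0, 0) is a ℚ-rational point of order 2", [52, III, 2.3])] -/
theorem nonsingular_zero_of_a₆ {W : WeierstrassCurve K} (h6 : W.a₆ = 0) (h4 : W.a₄ ≠ 0) :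
    W.toAffine.Nonsingular 0 0 :=
  (WeierstrassCurve.Affine.nonsingular_zero).2 ⟨h6, Or.inr h4⟩

/-- If moreover `a₃ = 0`, the point `(0, 0)` has order `2`: it is non-zero and `P + P = 0`
(it is its own negative). [cite: BennettSkinner2004, Lemma 2.1(c)] -/
theorem twoTorsion_of_a₃_a₆ {W : WeierstrassCurve K} (h3 : W.a₃ = 0) (h6 : W.a₆ = 0)
    (h4 : W.a₄ ≠ 0) :
    WeierstrassCurve.Affine.Point.some 0 0 (nonsingular_zero_of_a₆ h6 h4) ≠ 0 ∧
      WeierstrassCurve.Affine.Point.some 0 0 (nonsingular_zero_of_a₆ h6 h4) +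
        WeierstrassCurve.Affine.Point.some 0 0 (nonsingular_zero_of_a₆ h6 h4) = 0 :=
  ⟨WeierstrassCurve.Affine.Point.some_ne_zero _,
    WeierstrassCurve.Affine.Point.add_self_of_Y_eq (by simp [WeierstrassCurve.Affine.negY, h3])⟩

/-- **Lemma 2.1(c) for `E₁`** (over a field, `BC b ≠ 0`): `(0,0)` is a rational point of order 2.
[cite: BennettSkinner2004, Lemma 2.1(c)] -/
theorem twoTorsion_E₁ {B C b c : K} {n : ℕ} (hB : B ≠ 0) (hC : C ≠ 0) (hb : b ≠ 0) :
    ∃ h : (E₁ B C b c n).toAffine.Nonsingular 0 0,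
      WeierstrassCurve.Affine.Point.some 0 0 h ≠ 0 ∧
        WeierstrassCurve.Affine.Point.some 0 0 h + WeierstrassCurve.Affine.Point.some 0 0 h = 0 :=
  ⟨_, twoTorsion_of_a₃_a₆ (W := E₁ B C b c n) rfl rfl (by simp [hB, hC, hb])⟩

/-- **Lemma 2.1(c) for `E₂`** (field with `2 ≠ 0`, `BC b ≠ 0`). [cite: BennettSkinner2004, Lemma 2.1(c)] -/
theorem twoTorsion_E₂ [NeZero (2 : K)] {B C b c : K} {n : ℕ} (hB : B ≠ 0) (hC : C ≠ 0)
    (hb : b ≠ 0) :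
    ∃ h : (E₂ B C b c n).toAffine.Nonsingular 0 0,
      WeierstrassCurve.Affine.Point.some 0 0 h ≠ 0 ∧
        WeierstrassCurve.Affine.Point.some 0 0 h + WeierstrassCurve.Affine.Point.some 0 0 h = 0 :=
  ⟨_, twoTorsion_of_a₃_a₆ (W := E₂ B C b c n) rfl rfl (by simp [hB, hC, hb, four_ne_zero'])⟩

/-- **Lemma 2.1(c) for `E₃`** (field with `2 ≠ 0`, `BC b ≠ 0`). [cite: BennettSkinner2004, Lemma 2.1(c)] -/
theorem twoTorsion_E₃ [NeZero (2 : K)] {B C b c : K} {n : ℕ} (hB : B ≠ 0) (hC : C ≠ 0)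
    (hb : b ≠ 0) :
    ∃ h : (E₃ B C b c n).toAffine.Nonsingular 0 0,
      WeierstrassCurve.Affine.Point.some 0 0 h ≠ 0 ∧
        WeierstrassCurve.Affine.Point.some 0 0 h + WeierstrassCurve.Affine.Point.some 0 0 h = 0 := by
  have h64 : (64 : K) ≠ 0 := by
    have : (64 : K) = 2 ^ 6 := by norm_num
    rw [this]; exact pow_two_ne_zero' 6
  exact ⟨_, twoTorsion_of_a₃_a₆ (W := E₃ B C b c n) rfl rfl (by simp [hB, hC, hb, h64])⟩

end Torsion

end Field

/-! ## Appendix (lit g12, second pass): the j-invariants (Corollary 2.2's object)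

[BS04, Cor 2.2, p. 29]: *"If `n ≥ 7` is prime and `abAB` is divisible by an odd prime `p`, then the
j-invariant `j(E)` of the curve `E = E_i(a, b, c)` satisfies `ord_p j(E) < 0`."* The closed form below
(computed from the printed models; the same for `i = 1, 2, 3`, the three curves being twists of one
another) makes the denominator `AB²(ab²)ⁿ` visible. -/

section JInvariant

variable {K : Type*} [Field K]

/-- **j-invariant of `E₁`** (over a field, `E₁` elliptic): with `A aⁿ + B bⁿ = C c²`,
`j(E₁) = 64·(4A aⁿ + B bⁿ)³ / (A B² (ab²)ⁿ)` — denominator `AB²(ab²)ⁿ` as used in Cor 2.2.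
[cite: BennettSkinner2004, Lemma 2.1(a) + Cor 2.2 (j(E_i))] -/
theorem j_E₁ {A B C a b c : K} {n : ℕ} [hE : (E₁ B C b c n).IsElliptic]
    (h : A * a ^ n + B * b ^ n = C * c ^ 2) :
    (E₁ B C b c n).j = 64 * (4 * A * a ^ n + B * b ^ n) ^ 3 / (A * B ^ 2 * (a * b ^ 2) ^ n) := by
  have hΔ : (E₁ B C b c n).Δ ≠ 0 := (E₁ B C b c n).isUnit_Δ.ne_zero
  have hΔ' := hΔ
  rw [Δ_E₁ h] at hΔ'
  have h2 : (2 : K) ^ 6 ≠ 0 := by intro h0; apply hΔ'; rw [h0]; ring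
  have hA : A ≠ 0 := by intro h0; apply hΔ'; rw [h0]; ring
  have hB : B ≠ 0 := by intro h0; apply hΔ'; rw [h0]; ring
  have hC : C ^ 3 ≠ 0 := by intro h0; apply hΔ'; rw [h0]; ring
  have hab : (a * b ^ 2) ^ n ≠ 0 := by intro h0; apply hΔ'; rw [h0]; ring
  have hden : A * B ^ 2 * (a * b ^ 2) ^ n ≠ 0 := mul_ne_zero (mul_ne_zero hA (pow_ne_zero 2 hB)) hab
  rw [WeierstrassCurve.j, Units.val_inv_eq_inv_val, WeierstrassCurve.coe_Δ', Δ_E₁ h,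
    c₄_E₁_of_rel h, inv_mul_eq_div, div_eq_div_iff hΔ' hden]
  ring

/-- **j-invariant of `E₂`** (field with `2 ≠ 0`, `E₂` elliptic): the same value
`64·(4A aⁿ + B bⁿ)³ / (A B² (ab²)ⁿ)`. [cite: BennettSkinner2004, Lemma 2.1(a) + Cor 2.2 (j(E_i))] -/
theorem j_E₂ [NeZero (2 : K)] {A B C a b c : K} {n : ℕ} [hE : (E₂ B C b c n).IsElliptic]
    (h : A * a ^ n + B * b ^ n = C * c ^ 2) :
    (E₂ B C b c n).j = 64 * (4 * A * a ^ n + B * b ^ n) ^ 3 / (A * B ^ 2 * (a * b ^ 2) ^ n) := by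
  have hΔ : (E₂ B C b c n).Δ ≠ 0 := (E₂ B C b c n).isUnit_Δ.ne_zero
  have hΔ' := hΔ
  rw [Δ_E₂ h] at hΔ'
  have hA : A ≠ 0 := by intro h0; apply hΔ'; rw [h0]; ring
  have hB : B ≠ 0 := by intro h0; apply hΔ'; rw [h0]; ring
  have hab : (a * b ^ 2) ^ n ≠ 0 := by intro h0; apply hΔ'; rw [h0]; ring
  have hden : A * B ^ 2 * (a * b ^ 2) ^ n ≠ 0 := mul_ne_zero (mul_ne_zero hA (pow_ne_zero 2 hB)) hab
  have hc4 : (E₂ B C b c n).c₄ = 4 * C * (4 * A * a ^ n + B * b ^ n) := by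
    rw [c₄_E₂]; linear_combination (-(16 * C)) * h
  rw [WeierstrassCurve.j, Units.val_inv_eq_inv_val, WeierstrassCurve.coe_Δ', Δ_E₂ h, hc4,
    inv_mul_eq_div, div_eq_div_iff hΔ' hden]
  ring

/-- **j-invariant of `E₃`** (field with `2 ≠ 0`, `E₃` elliptic): the same value
`64·(4A aⁿ + B bⁿ)³ / (A B² (ab²)ⁿ)`. [cite: BennettSkinner2004, Lemma 2.1(a) + Cor 2.2 (j(E_i))] -/
theorem j_E₃ [NeZero (2 : K)] {A B C a b c : K} {n : ℕ} [hE : (E₃ B C b c n).IsElliptic]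
    (h : A * a ^ n + B * b ^ n = C * c ^ 2) :
    (E₃ B C b c n).j = 64 * (4 * A * a ^ n + B * b ^ n) ^ 3 / (A * B ^ 2 * (a * b ^ 2) ^ n) := by
  have hΔ : (E₃ B C b c n).Δ ≠ 0 := (E₃ B C b c n).isUnit_Δ.ne_zero
  have hΔ' := hΔ
  rw [Δ_E₃ h] at hΔ'
  have h2 : (2 : K) ^ 12 ≠ 0 := pow_ne_zero 12 (NeZero.ne 2)
  have hnum : C ^ 3 * B ^ 2 * A * (a * b ^ 2) ^ n ≠ 0 := by
    intro h0; apply hΔ'; rw [h0, zero_div]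
  have hA : A ≠ 0 := by intro h0; apply hnum; rw [h0]; ring
  have hB : B ≠ 0 := by intro h0; apply hnum; rw [h0]; ring
  have hab : (a * b ^ 2) ^ n ≠ 0 := by intro h0; apply hnum; rw [h0]; ring
  have hden : A * B ^ 2 * (a * b ^ 2) ^ n ≠ 0 := mul_ne_zero (mul_ne_zero hA (pow_ne_zero 2 hB)) hab
  have h4 : (4 : K) ≠ 0 := by
    rw [show (4 : K) = 2 ^ 2 by norm_num]; exact pow_ne_zero 2 (NeZero.ne 2)
  have hc4 : (E₃ B C b c n).c₄ = C * (4 * A * a ^ n + B * b ^ n) / 4 := by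
    rw [c₄_E₃]; congr 1; linear_combination (-(4 * C)) * h
  rw [WeierstrassCurve.j, Units.val_inv_eq_inv_val, WeierstrassCurve.coe_Δ', Δ_E₃ h, hc4,
    inv_mul_eq_div, div_eq_div_iff hΔ' hden]
  field_simp
  ring

end JInvariant

end BennettSkinner2004

end Literature.NumberTheory.DiophantineGeometry
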